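import Mathlib
import Summits.Ventures.PercRepro2.LocRows
import Summits.Ventures.PercRepro2.SwRow
import Summits.Ventures.PercRepro2.SwOut
import Summits.Ventures.PercRepro2.SwAllRow
import Summits.Ventures.PercRepro2.SwOutAll
import Summits.Ventures.PercRepro2.SwOutArmFlip
import Summits.Ventures.PercRepro2.SwOutArmThm
import Summits.Ventures.PercRepro2.SwOutJunction
import Summits.Ventures.PercRepro2.SwOutJunctionRegion
import Summits.Ventures.PercRepro2.SwOutCoreDefs
import Summits.Ventures.PercRepro2.SwOutCoreKey
import Summits.Ventures.PercRepro2.SwOutJunctionH1Defs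
import Summits.Ventures.PercRepro2.SwOutJunctionH1Arms
import Summits.Ventures.PercRepro2.SwOutJunctionH1Cover

/-!
# The (H1) single junction: inside connectivity of the arms (blind cell PercRepro2, night-4 g13,
2026-08-26; proofs/NIGHT4-G13.md §4 (C1))

On the red side of a configuration `η` (the sides disjoint), every vertex of an arm containing a
neighbour of `h` is red-connected to `h` INSIDE the arm with `h` (`harm_conn_red`), and every
vertex of a pure arm is red-connected to `u` inside the arm with `u` (`pure_conn_red`).  Both are
closure arguments on the set «outside the arm, or inside-connected»: a red edge into the arm comes
from the arm itself, from `h`, from `u` — where (H1) supplies a direct red edge from `h` to the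
entry vertex of an h-arm (its component is not pure, so the entry vertex is adjacent to `h`, and
the edge is red since the vertex is on the red side) — or from another vertex of `H⁺`, impossible
across arms, or from outside `H⁺`, impossible for a red edge.
-/

namespace Summit.Ventures.PercRepro2

namespace LocRows

open Hull

variable {V : Type*} {E : Type*} [Fintype E] [DecidableEq E]

open scoped Classical

variable {ends : E → Sym2 V} {U : Set V} {h u : V} {η : Config E}

omit [Fintype E] [DecidableEq E] in
/-- The arm of `w` lies in the component of `w` in `G[U ∖ {h, u}]` when `H⁺ ⊆ U`. -/
lemma armC_subset_compU (hHU : extHull ends η h u ⊆ U) (w : V) :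
    armC ends h u η w ⊆ compU ends U h u w := by
  apply cluster_mono
  intro e
  by_cases he : armConfigC ends h u η e = true
  · rw [he]
    obtain ⟨x, hx, y, hy, hxy⟩ := armConfigC_eq_true_iff.1 he
    have : e ∈ within ends (U \ {h, u}) :=
      ⟨x, ⟨hHU hx.1, hx.2⟩, y, ⟨hHU hy.1, hy.2⟩, hxy⟩
    simp [this]
  · simp only [Bool.not_eq_true] at he
    rw [he]
    exact Bool.false_le _

omit [Fintype E] [DecidableEq E] in
/-- A red edge from a vertex of the red side leads into `H⁺`. -/
lemma mem_extHull_of_red_of_mem_redExt {e : E} {a b : V} (hends : ends e = s(a, b))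
    (ha : a ∈ redExt ends h u η) (he : η e = true) : b ∈ extHull ends η h u := by
  rw [mem_redExt_iff] at ha
  rcases ha.1 with ha' | ha'
  · exact Or.inl (Or.inl (mem_cluster_of_edge ha' he hends))
  · exact Or.inr (Or.inl (mem_cluster_of_edge ha' he hends))

omit [DecidableEq E] in
/-- An arm is the arm of each of its vertices. -/
lemma armsC_eq_armC_of_mem {P : Set V} (hP : P ∈ armsC ends h u η) {b : V} (hb : b ∈ P) :
    P = armC ends h u η b := by
  obtain ⟨y, _, _, _, rfl⟩ := exists_of_mem_armsC hP
  exact (armC_eq_of_mem hb).symm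

omit [DecidableEq E] in
/-- A red edge into an arm from a vertex of `H⁺ ∖ {h, u}` comes from the arm. -/
lemma mem_armsC_of_red_edge {P : Set V} (hP : P ∈ armsC ends h u η) (hPR : P ⊆ redExt ends h u η)
    {e : E} {a b : V} (hends : ends e = s(a, b)) (hb : b ∈ P) (he : η e = true) (hah : a ≠ h)
    (hau : a ≠ u) : a ∈ P := by
  obtain ⟨hbH, hbh, hbu⟩ := armsC_subset hP b hb
  have haH : a ∈ extHull ends η h u :=
    mem_extHull_of_red_of_mem_redExt (ends_swap hends) (hPR hb) he
  rw [armsC_eq_armC_of_mem hP hb]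
  exact mem_armC_of_edge (mem_armC_self b) hbH hbh hbu haH hah hau (ends_swap hends)

omit [DecidableEq E] in
/-- **Inside connectivity of an h-arm on the red side** (under (H1), `H⁺ ⊆ U`, the sides
disjoint). -/
theorem harm_conn_red (hH1 : H1 ends U h u) (hHU : extHull ends η h u ⊆ U)
    (hdisj : ∀ x, x ∈ redExt ends h u η → x ∈ blueExt ends η h u → False)
    {P : Set V} (hP : P ∈ armsC ends h u η) (hPR : P ⊆ redExt ends h u η)
    (hy : ∃ e y, ends e = s(h, y) ∧ y ∈ P) :
    ∀ x ∈ P, x ∈ cluster ends (insideConfig ends (P ∪ {h}) η) h := by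
  have hPsub := armsC_subset hP
  have hhP : h ∉ P := fun hh => (hPsub h hh).2.1 rfl
  have huP : u ∉ P := fun hu => (hPsub u hu).2.2 rfl
  let S : Set V := {v | v ∉ P ∨ v ∈ cluster ends (insideConfig ends (P ∪ {h}) η) h}
  have hclosed : ∀ a ∈ S, ∀ b, (openGraph ends η).Adj a b → b ∈ S := by
    intro a ha b hab
    obtain ⟨hne, e, he, hends⟩ := openGraph_adj.1 hab
    by_cases hbP : b ∈ P
    · right
      by_cases haP : a ∈ P
      · -- inside the arm
        have hin : insideConfig ends (P ∪ {h}) η e = true :=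
          insideConfig_eq_true_iff.2 ⟨he, a, Or.inl haP, b, Or.inl hbP, hends⟩
        rcases ha with ha | ha
        · exact absurd haP ha
        · exact mem_cluster_of_edge ha hin hends
      by_cases hah : a = h
      · -- from `h`
        rw [hah] at hends
        have hin : insideConfig ends (P ∪ {h}) η e = true :=
          insideConfig_eq_true_iff.2 ⟨he, h, Or.inr rfl, b, Or.inl hbP, hends⟩
        exact mem_cluster_of_edge (mem_cluster_self _ _ _) hin hends
      by_cases hau : a = u
      · -- from `u`: (H1) gives a red edge from `h` to `b`
        rw [hau] at hends
        rcases hH1 e b hends with ⟨e', he'⟩ | hpure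
        · have hred : η e' = true := by
            by_contra hblue
            simp only [Bool.not_eq_true] at hblue
            have hb' : blue η e' = true := by rw [blue_eq_true_iff]; exact hblue
            have hbB : b ∈ blueExt ends η h u := by
              rw [mem_blueExt_iff]
              exact ⟨Or.inl (mem_cluster_of_edge (mem_cluster_self _ _ _) hb' (ends_swap he')),
                (hPsub b hbP).2.1, (hPsub b hbP).2.2⟩
            exact hdisj b (hPR hbP) hbB
          have hin : insideConfig ends (P ∪ {h}) η e' = true :=
            insideConfig_eq_true_iff.2 ⟨hred, h, Or.inr rfl, b, Or.inl hbP, ends_swap he'⟩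
          exact mem_cluster_of_edge (mem_cluster_self _ _ _) hin (ends_swap he')
        · exfalso
          obtain ⟨ey, y, hey, hyP⟩ := hy
          have hyC : y ∈ compU ends U h u b := by
            rw [armsC_eq_armC_of_mem hP hbP] at hyP
            exact armC_subset_compU hHU b hyP
          exact hpure y hyC ey hey
      · -- from a vertex of `H⁺ ∖ {h, u}` outside the arm: impossible
        exact absurd (mem_armsC_of_red_edge hP hPR hends hbP he hah hau) haP
    · exact Or.inl hbP
  intro x hx
  have hxR := hPR hx
  rw [mem_redExt_iff] at hxR
  have hxS : x ∈ S := by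
    rcases hxR.1 with hx' | hx'
    · exact mem_of_conn_of_closed hclosed (Or.inl hhP) hx'
    · exact mem_of_conn_of_closed hclosed (Or.inl huP) hx'
  rcases hxS with h' | h'
  · exact absurd hx h'
  · exact h'

omit [DecidableEq E] in
/-- **Inside connectivity of a pure arm on the red side** (the sides disjoint). -/
theorem pure_conn_red {P : Set V} (hP : P ∈ armsC ends h u η) (hPR : P ⊆ redExt ends h u η)
    (hpure : pureC ends h P) :
    ∀ x ∈ P, x ∈ cluster ends (insideConfig ends (P ∪ {u}) η) u := by
  have hPsub := armsC_subset hP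
  have hhP : h ∉ P := fun hh => (hPsub h hh).2.1 rfl
  have huP : u ∉ P := fun hu => (hPsub u hu).2.2 rfl
  let S : Set V := {v | v ∉ P ∨ v ∈ cluster ends (insideConfig ends (P ∪ {u}) η) u}
  have hclosed : ∀ a ∈ S, ∀ b, (openGraph ends η).Adj a b → b ∈ S := by
    intro a ha b hab
    obtain ⟨hne, e, he, hends⟩ := openGraph_adj.1 hab
    by_cases hbP : b ∈ P
    · right
      by_cases haP : a ∈ P
      · have hin : insideConfig ends (P ∪ {u}) η e = true :=
          insideConfig_eq_true_iff.2 ⟨he, a, Or.inl haP, b, Or.inl hbP, hends⟩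
        rcases ha with ha | ha
        · exact absurd haP ha
        · exact mem_cluster_of_edge ha hin hends
      by_cases hau : a = u
      · rw [hau] at hends
        have hin : insideConfig ends (P ∪ {u}) η e = true :=
          insideConfig_eq_true_iff.2 ⟨he, u, Or.inr rfl, b, Or.inl hbP, hends⟩
        exact mem_cluster_of_edge (mem_cluster_self _ _ _) hin hends
      by_cases hah : a = h
      · exfalso
        rw [hah] at hends
        exact hpure e b hends hbP
      · exact absurd (mem_armsC_of_red_edge hP hPR hends hbP he hah hau) haP
    · exact Or.inl hbP
  intro x hx
  have hxR := hPR hx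
  rw [mem_redExt_iff] at hxR
  have hxS : x ∈ S := by
    rcases hxR.1 with hx' | hx'
    · exact mem_of_conn_of_closed hclosed (Or.inl hhP) hx'
    · exact mem_of_conn_of_closed hclosed (Or.inl huP) hx'
  rcases hxS with h' | h'
  · exact absurd hx h'
  · exact h'

end LocRows

end Summit.Ventures.PercRepro2
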